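import Summits.QuantumFields.YangMills.Theorems.BalabanUVNodesN12Prop1DirectOfChartHalfOfClassExplicit
import Summits.QuantumFields.YangMills.Theorems.BalabanUVNodesN12DirectSurjHsurjProxies
import Summits.QuantumFields.YangMills.Theorems.BalabanUVNodesN12SiteProxiesOfClass
import Summits.QuantumFields.YangMills.Theorems.BalabanUVNodesN12ChartCurvatureOfClass

/-!
# BalabanUVNodes ∕ N12 — (D1)‴ `(iii)_direct`, EXPLICIT-THRESHOLD FRAME, NO SMALL-BELOW LETTER: (P2c)″ (hsb-free chart half) WITH THE (P4)′ SOCKET fed by dag-n12-w6 g7's PROXIES edition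
# `N12DirectSurjHsurjProxies.exists_rightInverse_letter_of_proxies` and THE (P5) ROW fed by dag-n12-c g21's `N12ChartCurvatureOfClass.norm_fderiv_fderiv_msChart_le_of_class` — every fact about
# the minimiser read off its (2.12) class (LOCATED-HSB repaired end-to-end on the knit side)

Cell `pub-ymgap` (HUMAN RULINGS D-0062 ∕ D-0149), seat `pub-ymgap-dag-n12-d` g20 (R134 N12 [B15] s2; the lane's v9 recipe INBOX l.44121 «hsb LEAVES THE ROAD»).  Count-neutral helper of K1⁹
`stmt-QuantumFields-27364` (`--kind proof --supports … --as helper`).  THEOREMS ONLY (0 `def`, 0 `instance`, 0 `sorry`); composition BY NAME of this seat's (P2c)″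
`N12Prop1DirectOfChartHalfOfClassExplicit.…_ofWindowGaugeLetter_ofChartHalfOfClass_explicit`, dag-n12-c g21's ρ5b `N12TowerProxiesOfClass.towerProxies_Bj_of_mem_class` (p677953), §3b
`N12SiteProxiesOfClass.siteProxies_Bj_of_mem_class` (p679665) and ρ5d `N12ChartCurvatureOfClass.norm_fderiv_fderiv_msChart_le_of_class` (p679666); in §2 dag-n12-w6 g7's
`N12DirectSurjHsurjProxies.exists_rightInverse_letter_of_proxies` (p678596) and dag-n12-w4's `Node00.exists_uniform_chartCurvature_sq_bound` (p615328 lineage).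

WHY (LOCATED-HSB, lane census D4′ ∕ v2).  (D1) ∕ (D1)′ ∕ (D1)″ displayed `hsb : SmallBelow (avOfRecord F 2 Kt) (k i) U₀` for EVERY guarded minimiser — the (0.4) guard of every iterated
average at every coarse bond of the torus, also far from the support, where data are rough: unsatisfiable in the large-field regime the road is built for.  It was the premise of three
producers: the chart rows ∕ half (repaired by the lane's ρ5c — (P2c)″), the (P4)′ right inverse (repaired by dag-n12-w6's proxies edition p678596: one guarded PROXY per constrained bond and per
inner site, agreeing with `U₀` on the relevant towers), the (P5) curvature (repaired by the lane's ρ5d p679666: gauge covariance of the chart + conjugated `D²` at a near-flat core).  Here all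
three repairs are consumed: the proxies come from the class by name (ρ5b p677953 per bond, p679665 per site), the curvature bound from p679666 — so NO small-below letter is displayed.

WHAT.  (P2c)″'s statement VERBATIM except: (a) `hH` GONE; binders `(εH B M₂ ρ6 : ι → ℝ) (hB0) (hM₂0)` and letters `hHB i` (p678596's ∀-body at `(2, Kt, k i, ν.M₁, Z i; εH i, B i)`),
`hsbU i : ∀ V, ‖coeField V − 1‖ ≤ ρ6 i → SmallBelow (k i) V`, `hcurv i : ∀ 𝔹 Wd V, ‖coeField V − 1‖ ≤ ρ6 i → AgreeOn 𝔹 (M˙V) Wd → ∀ w, ‖D²Ψ_{𝔹,Wd,V}(0)(w,w)‖ ≤ M₂ i‖w‖²` and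
the floor `hερ6 : ∀ i, 6(d−1)L·εreg ≤ ρ6 i`; (b) `hM₂` GONE; (c) threshold row `δ i ≤ min (Θ i) (εH i)`; (d) the tower-box plaquette letter `hPbox` at `δ i` after `hPχ` in the frame.  Per-instance
display: (J0′) `hMin`@eR · geometry · numerics (incl. `hk1 hM4 hεreg hερ hερ6`) · chart half `C ρ Kτ ρτ ρ5`+`hhalf` · (P4)′ `εH B`+`hHB` · (P5)∕guard `ρ6 M₂`+`hsbU hcurv` · [15] Thm 1 `h15T` ·
under the threshold `hσW hPχ hPbox` (discharged downstream in (E1)).  PROOF: one term.  §2: the two displayed letter families are inhabited (`choose`).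

HONEST FRAMING ∕ LOCATED.  ∃∕∀ bookkeeping by name; all displayed letters now have by-name producers except the node-level inputs (J0′) `hMin` and `h15T` and the tolerance letters
(discharged in (E1)); per-height ∕ per-instance EXISTENCE constants (print's volume-uniform (46)∕(83) NOT claimed); nothing of Bałaban's asserted; count-neutral; N12 NOT discharged; K1⁹
NOT closed; counts unmoved; one finite 𝕋⁴ programme at fixed `ε = L^{-K}` — R4 closes only the conditional rung `BalabanLadder.UV`; no summit statement is proved here and NOT the
Yang–Mills mass gap (Clay); nothing continuum ∕ ℝ⁴ ∕ OS.

References: [Balaban1989LargeFieldI] CMP 122 (1989) 175–202, (1.74) p.192, Prop. 1 (1.77)–(1.78) p.194, (1.79) p.195; [Balaban1989LargeFieldII] CMP 122 (1989) 355–392, p.357,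
(1.7)–(1.9) p.358, (1.12)–(1.13) p.359; [Balaban1985Variational] CMP 102 (1985) 277–309, (2)–(4) p.278, Thm 1 (8) p.279, (44)–(48) p.285, (81)–(83) p.290; [Balaban1985Averaging]
CMP 98 (1985) 17–51, (19) p.21; [Balaban1988Convergent] CMP 119 (1988) 243–285, (2.2) p.255, (2.10)–(2.14) pp.256–257.
-/

noncomputable section

open Set Finset Metric Filter
open scoped BigOperators Matrix RealInnerProductSpace Real InnerProductSpace Topology Matrix.Norms.L2Operator

namespace Summit.QuantumFields.YangMills.BalabanUVNodes.N12Prop1DirectOfClassOnly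

open Literature.MathematicalPhysics.QuantumFieldTheory.Balaban1983to89
open T4Continuum B15DeterminingSets GaugeField B16Sect1Backgrounds B15Prop1Carrier B8Eq17ClassAkV1 BlockAveraging
open B15Prop1SliceTaylorCalculus
open B15Prop1ChartCalculusSU2 (E3)
open T4CubeChartGnomonic (SU2)
open B15Prop1ChartSU2 (su2Chart)
open B15Prop1SliceCoordinates (GaugeSlice ιA freeBonds)
open B15Prop1AnalyticExtClause (cplxVec anExt)
open T4AdjointCovarianceUnitary (lieSU)
open T4AxialGaugeSmallField (castSite boxPlaqs boxBonds)
open B6BondElimination (unitVec)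
open B6TreeGaugePoincare (curl)
open B16Eq18Proof (box mem_box)
open B15Extension193 (extend)
open B15ShellGauge193 (shellGauge)
open B14.Eq213MaximalDomains (side)
open B14.Eq213DetSet B14.Eq216Concrete B15Sect1Instances B15Eq177GaugeInvariance B15Eq177ValueInvariance B15Eq177ValueInvarianceCoDiv B16Sect1Wilson
open B14.Eq22Determines (blockIter IsBlockUnion)
open Literature.MathematicalPhysics.QuantumFieldTheory.BalabanImbrieJaffe1984to88.BIJ85Eq453GaugeField
open Node00 (expChart msChart constrCard)
open B15Eq112TorusCover (lift)
open B5Eq118OneStroke (iterBlockOf)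
open Summit.QuantumFields.YangMills.BalabanUVNodes.N12Prop1DirectOfChartHalfOfClassExplicit (exists_domain_prop1Printed_lfVarOn_std_su2_box_intrinsic_analytic_atZSeqCoPRecord_ofThm1TorusClass_ofMinimiserFamily_ofWindowGaugeLetter_ofChartHalfOfClass_explicit)
open Summit.QuantumFields.YangMills.BalabanUVNodes.N12TowerProxiesOfClass (towerProxies_Bj_of_mem_class)
open Summit.QuantumFields.YangMills.BalabanUVNodes.N12SiteProxiesOfClass (siteProxies_Bj_of_mem_class)
open Summit.QuantumFields.YangMills.BalabanUVNodes.N12ChartCurvatureOfClass (norm_fderiv_fderiv_msChart_le_of_class)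
open Summit.QuantumFields.YangMills.BalabanUVNodes.N12DirectSurjHsurjProxies (exists_rightInverse_letter_of_proxies)
open Node00 (avOfRecord regMSCoPOfRecord coeField constrEnum)
open B15Prop1NumericsThresholds (plaqSmallOn_of_le)

variable {F : T4Family}
/-- ★★★ **(D1)‴ `(iii)_direct` — THE SMALL-BELOW LETTER `hsb` LEAVES THE ROAD: (P2c)″ with the (P4)′ socket fed by dag-n12-w6 g7's PROXIES edition and the (P5) row fed by the lane's
class curvature bound.**  (P2c)″'s statement with: `hH` GONE — binders `εH B` + the letter `hHB` = the ∀-body of `exists_rightInverse_letter_of_proxies` (p678596; premises = the fibre clause,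
guarded PROXIES per constrained bond and per inner site, the tower-box plaquette letter at `εH i` — NO `SmallBelow U₀`); `hM₂` GONE — binders `ρ6 M₂` + letters `hsbU hcurv` (the two conjuncts of
`Node00.exists_uniform_chartCurvature_sq_bound (k i)`) + floor `hερ6 : 6(d−1)L·εreg ≤ ρ6 i`; `hPbox` in the frame at `δ i`; threshold `min (Θ i) (εH i)`.  Proof: (P2c)″ with
`hH := hHB ∘ (IsMinimizer….2.1, towerProxies_Bj_of_mem_class … hmin.1, siteProxies_Bj_of_mem_class … hmin.1, plaqSmallOn_of_le ∘ hPbox)` and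
`hM₂ := norm_fderiv_fderiv_msChart_le_of_class … hsbU hcurv hερ6 hmin` — every minimiser fact read off its (2.12) class; §2: the two letter families are inhabited by `choose`.
[cite: Balaban1989LargeFieldI, (1.74) p.192, Prop. 1 (1.77)–(1.78) p.194, (1.79) p.195; Balaban1989LargeFieldII, p.357, (1.7)–(1.9) p.358, (1.12)–(1.13) p.359; Balaban1985Variational, (2)–(4) p.278, Thm 1 (8) p.279, (44)–(48) p.285, (81)–(83) p.290; Balaban1985Averaging, (19) p.21; Balaban1988Convergent, (2.2) p.255, (2.10)–(2.14) pp.256–257] -/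
theorem exists_domain_prop1Printed_lfVarOn_std_su2_box_intrinsic_analytic_atZSeqCoPRecord_ofThm1TorusClass_ofMinimiserFamily_ofWindowGaugeLetter_ofClassOnly_explicit
    (ν : Node00.Stage7Numerics) (Kt : ℕ) (hd3 : 3 ≤ (F.P Kt).d) (h0 : 0 < (F.P Kt).d) {ι : Type}
    (Z Λ : ι → Set (Site (F.P Kt) 0)) (k : ι → ℕ) (M : ι → ℝ) (hk0 : ∀ i, 0 < k i) (hk1 : ∀ i, k i + 1 ≤ (F.P Kt).m + (F.P Kt).K)
    (eR : ι → ℝ) (heR : ∀ i, 0 < eR i)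
    (T : ∀ i, Finset (PBond (F.P Kt) (k i)))
    (lo hi : ι → Fin (F.P Kt).d → ℤ) (n : ι → ℕ) (hn : ∀ i κ, hi i κ ≤ lo i κ + n i) (hN : ∀ i, n i + 2 < (F.P Kt).sitesPerDir (k i))
    (hbox : ∀ i, pts (k i) (Λ i) = (castSite '' Set.Icc (lo i) (hi i) : Set (Site (F.P Kt) (k i))))
    (hZ : ∀ i, (boxPlaqs (lo i - 1) (hi i + 1) : Set (Plaq (F.P Kt) (k i))) ⊆ plaqsInside (pts (k i) (Z i)))
    (hTG0 : ∀ i, T i = (box (fun κ => (hi i κ - lo i κ + 1).toNat) (lo i)).image fun x =>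
      (⟨castSite (x - unitVec ⟨0, h0⟩), ⟨0, h0⟩⟩ : PBond (F.P Kt) (k i)))
    (hN5 : ∀ i κ, ((hi i κ - lo i κ + 1).toNat : ℤ) + 5 < (F.P Kt).sitesPerDir (k i))
    (K : ι → ℕ) (hK1 : ∀ i, 1 ≤ K i) (hKn : ∀ i κ, (hi i κ - lo i κ + 1).toNat ≤ K i)
    (ext : ∀ i, GaugeField (F.P Kt) (k i) SU2 → GaugeField (F.P Kt) (k i) SU2)
    (hext : ∀ i Vk, ext i Vk = extend (pts (k i) (Λ i)) (shellGauge Vk (lo i) (hi i)) Vk)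
    (hlohi : ∀ i, lo i ≤ hi i)
    -- the REGION parallelepipeds of the normalisation and the datum tolerances
    (LO HI : ι → Fin (F.P Kt).d → ℤ) (hLO : ∀ i, LO i ≤ lo i - 1) (hHI : ∀ i, hi i + 1 ≤ HI i) (n' : ι → ℕ) (hn' : ∀ i κ, HI i κ ≤ LO i κ + n' i)
    (hn'N : ∀ i, n' i < (F.P Kt).sitesPerDir (k i)) (hR' : ∀ i, (boxPlaqs (LO i) (HI i) : Set (Plaq (F.P Kt) (k i))) ⊆ plaqsInside (pts (k i) (Z i)))
    (ρn : ι → ℝ)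
    (hρn : ∀ i, (((F.P Kt).d : ℝ) * n' i + 1) * ((((F.P Kt).d - 1 : ℕ) : ℝ) * n' i * ((12 * (F.P Kt).d * (n i + 2) ^ 2 + 1) * eR i)
      + 3 * (F.P Kt).d * (n i + 2) ^ 2 * eR i) ≤ ρn i)
    {γ cJ bx : ℝ} (hγ : 0 < γ) (hcJ : 0 ≤ cJ) (hbx : 0 ≤ bx)
    (hbxM : ∀ i, 12 * ((F.P Kt).d : ℝ) * ((n i : ℝ) + 2) ^ 2 ≤ bx * (M i) ^ 2)
    {R 𝓐₀ : ι → ℝ} (hM : ∀ i, 1 ≤ (M i)) (hR : ∀ i, 0 < R i) (h𝓐₀ : ∀ i, 0 ≤ 𝓐₀ i)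
    -- (J0′), R-EXPLICIT: per instance one radius and one bound for every base field of the strict guard
    (hMin : ∀ i Vk, PlaqSmallOn (plaqsInside (pts (k i) (Z i ∩ (Λ i)ᶜ))) (eR i) Vk →
      ∃ Ũ : VecField (F.P Kt) (k i) (EuclideanSpace ℂ (Fin 3)) × VecField (F.P Kt) (k i) (EuclideanSpace ℂ (Fin 3)) →
          PBond (F.P Kt) 0 → Matrix (Fin 2) (Fin 2) ℂ,
        (∀ b a c, DifferentiableOn ℂ (fun z => Ũ z b a c) (ball 0 (R i))) ∧
        (∀ z ∈ ball (0 : VecField (F.P Kt) (k i) (EuclideanSpace ℂ (Fin 3)) × VecField (F.P Kt) (k i) (EuclideanSpace ℂ (Fin 3))) (R i),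
          ∀ b a c, ‖Ũ z b a c‖ ≤ 𝓐₀ i) ∧
        ∀ p B' : VecField (F.P Kt) (k i) E3, ‖p‖ < R i → ‖B'‖ < R i → ∃ U' : GaugeField (F.P Kt) 0 SU2,
          (∀ b, Ũ (cplxVec p, cplxVec B') b = ((U' b : SU2) : Matrix (Fin 2) (Fin 2) ℂ)) ∧
            IsMinimizer (Node00.avOfRecord F 2 Kt) (Node00.regMSCoPOfRecord F 2 ν Kt (k i) (maxDomT ν.M₁ (Z i))) (Bj ν.M₁ (Z i) (k i))
              (avgFamily (Node00.avOfRecord F 2 Kt) (qsstarGIter0 (k i) (expMul su2Chart B' (ext i (expMul su2Chart p Vk))))) U')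
    -- dag-n12-w4's GEOMETRY letter of the chart file (the window box and its two shifts inside `Ω_k(Z)`)
    (hΩw : ∀ i, ∀ (ν' : Fin (F.P Kt).d), ∀ z ∈ box (fun κ => (hi i κ - lo i κ + 1).toNat + 3) (fun κ => lo i κ - 2),
      (castSite z : Site (F.P Kt) (k i)) ∈ pts (k i) (maxDomT ν.M₁ (Z i) (k i)) ∧
        (castSite z : Site (F.P Kt) (k i)).shift ⟨0, h0⟩ ∈ pts (k i) (maxDomT ν.M₁ (Z i) (k i)) ∧
        (castSite z : Site (F.P Kt) (k i)).shift ν' ∈ pts (k i) (maxDomT ν.M₁ (Z i) (k i)))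
    -- the WINDOW per instance, containing every plaquette whose source lies in the fine image of the enlarged window box (the chart half's `hW`)
    (W : ι → Finset (Plaq (F.P Kt) 0))
    (hWbox : ∀ i, ∀ q : Plaq (F.P Kt) 0, q.src ∈ ((box (fun κ => (F.P Kt).L ^ (k i) * ((hi i κ - lo i κ + 1).toNat + 3 + 1) - 1) (fun κ => ((F.P Kt).L : ℤ) ^ (k i) * (lo i κ - 2))).image
        (fun z => (castSite z : Site (F.P Kt) 0))) → q ∈ W i)
    -- THE CHART HALF, DISPLAYED and `hsb`-FREE (LOCATED-FLOOR + LOCATED-HSB): its FIVE per-height constants as BINDERS and ONE letter = the ∀-body of dag-n12-c g21's ρ5c-2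
    -- `N12DirectChartPackageOfClassFamily.exists_hWD_chartHalf_of_class_uniform_family` at height `k i` (NO `SmallBelow` premise; `ν Z Λ T lo hi` quantified inside; `choose` over ρ5c-2 discharges it)
    (C ρ Kτ ρτ ρ5 : ι → ℝ) (hρ : ∀ i, 0 < ρ i) (hKτ : ∀ i, 0 ≤ Kτ i) (hρτ : ∀ i, 0 < ρτ i)
    (hhalf : ∀ i,
        ∀ (ν : Node00.Stage7Numerics) (Z Λ : Set (Site (F.P Kt) 0)) (T : Finset (PBond (F.P Kt) (k i))) (lo hi : Fin (F.P Kt).d → ℤ),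
        (∀ κ, ((((hi κ - lo κ + 1).toNat + 3 : ℕ) : ℤ)) ≤ (F.P Kt).sitesPerDir (k i)) →
        (∀ (ν' : Fin (F.P Kt).d), ∀ z ∈ box (fun κ => (hi κ - lo κ + 1).toNat + 3) (fun κ => lo κ - 2),
          (castSite z : Site (F.P Kt) (k i)) ∈ pts (k i) (maxDomT ν.M₁ Z (k i)) ∧ (castSite z : Site (F.P Kt) (k i)).shift ⟨0, h0⟩ ∈ pts (k i) (maxDomT ν.M₁ Z (k i)) ∧
            (castSite z : Site (F.P Kt) (k i)).shift ν' ∈ pts (k i) (maxDomT ν.M₁ Z (k i))) →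
        (k i) + 1 ≤ (F.P Kt).m + (F.P Kt).K → 4 * (F.P Kt).L ≤ ν.M₁ → side (F.P Kt).L ν.M₁ (k i) ∣ (F.P Kt).sitesPerDir 0 → 0 ≤ ν.εreg →
        6 * ((((F.P Kt).d - 1 : ℕ)) : ℝ) * (F.P Kt).L * ν.εreg ≤ ρ5 i →
        ∀ (ext : GaugeField (F.P Kt) (k i) SU2 → GaugeField (F.P Kt) (k i) SU2) (Vk : GaugeField (F.P Kt) (k i) SU2) ⦃R 𝓐₀ : ℝ⦄, 0 < R → 0 ≤ 𝓐₀ →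
        ∀ (U₀ : GaugeField (F.P Kt) 0 SU2) (Xf : GaugeSlice (pts (k i) Λ) T E3 → PBond (F.P Kt) 0 → lieSU (Fin 2)),
        IsMinimizer (Node00.avOfRecord F 2 Kt) (Node00.regMSCoPOfRecord F 2 ν Kt (k i) (maxDomT ν.M₁ Z)) (Bj ν.M₁ Z (k i))
          (avgFamily (Node00.avOfRecord F 2 Kt) (qsstarGIter0 (k i) (ext Vk))) U₀ →
        ∀ ⦃εP : ℝ⦄, 0 ≤ εP →
        (∀ p : Plaq (F.P Kt) 0, ((⟨p.src, p.μ⟩ : PBond (F.P Kt) 0) ∈ {b : PBond (F.P Kt) 0 | b.src ∈ maxDomT ν.M₁ Z 1} ∨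
            (⟨p.src.shift p.μ, p.ν⟩ : PBond (F.P Kt) 0) ∈ {b : PBond (F.P Kt) 0 | b.src ∈ maxDomT ν.M₁ Z 1} ∨
            (⟨p.src.shift p.ν, p.μ⟩ : PBond (F.P Kt) 0) ∈ {b : PBond (F.P Kt) 0 | b.src ∈ maxDomT ν.M₁ Z 1} ∨
            (⟨p.src, p.ν⟩ : PBond (F.P Kt) 0) ∈ {b : PBond (F.P Kt) 0 | b.src ∈ maxDomT ν.M₁ Z 1}) →
          ‖((GaugeField.plaqHol U₀ p : SU2) : Matrix (Fin 2) (Fin 2) ℂ) - 1‖ ≤ εP) →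
        ∀ (H : (Fin (constrCard (Bj ν.M₁ Z (k i)) (k i)) → lieSU (Fin 2)) → PBond (F.P Kt) 0 → lieSU (Fin 2)) ⦃B : ℝ⦄, 0 ≤ B →
        (∀ v, fderiv ℝ (msChart F 2 Kt (k i) (Bj ν.M₁ Z (k i)) (avgFamily (avOfRecord F 2 Kt) (qsstarGIter0 (k i) (ext Vk))) U₀) 0 (H v) = v) →
        (∀ v, Real.sqrt (∑ b, ‖H v b‖ ^ 2) ≤ B * ‖v‖) →
        ∀ ⦃M₂ : ℝ⦄, 0 ≤ M₂ → (∀ w, ‖fderiv ℝ (fderiv ℝ (msChart F 2 Kt (k i) (Bj ν.M₁ Z (k i)) (avgFamily (avOfRecord F 2 Kt) (qsstarGIter0 (k i) (ext Vk))) U₀)) 0 w w‖ ≤ M₂ * ‖w‖ ^ 2) →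
        Xf 0 = 0 → ContDiffAt ℝ 2 Xf 0 →
        (∀ᶠ Y in 𝓝 (0 : GaugeSlice (pts (k i) Λ) T E3),
          IsMinimizer (Node00.avOfRecord F 2 Kt) (Node00.regMSCoPOfRecord F 2 ν Kt (k i) (maxDomT ν.M₁ Z)) (Bj ν.M₁ Z (k i))
            (avgFamily (Node00.avOfRecord F 2 Kt) (qsstarGIter0 (k i) (expMul su2Chart (ιA (pts (k i) Λ) T Y) (ext Vk)))) (expChart U₀ (Xf Y))) →
        (∀ (X : GaugeSlice (pts (k i) Λ) T E3) (b : PBond (F.P Kt) 0),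
          ‖((fderiv ℝ Xf 0 X b : lieSU (Fin 2)) : Matrix (Fin 2) (Fin 2) ℂ)‖ ≤ 8 * 𝓐₀ / R * ‖X‖ ∧ ‖fderiv ℝ Xf 0 X b‖ ≤ 12 * 𝓐₀ / R * ‖X‖) →
        (∀ (X : GaugeSlice (pts (k i) Λ) T E3) (b : PBond (F.P Kt) 0), b.src ∉ maxDomT ν.M₁ Z 1 → fderiv ℝ Xf 0 X b = 0) →
        ∀ (W : Finset (Plaq (F.P Kt) 0)),
        (∀ q : Plaq (F.P Kt) 0, q.src ∈ ((box (fun κ => (F.P Kt).L ^ (k i) * ((hi κ - lo κ + 1).toNat + 3 + 1) - 1) (fun κ => ((F.P Kt).L : ℤ) ^ (k i) * (lo κ - 2))).image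
            (fun z => (castSite z : Site (F.P Kt) 0))) → q ∈ W) →
        ∀ ⦃δW : ℝ⦄, 0 < δW → δW < ρ i → δW < ρτ i →
        (∀ (ν' : Fin (F.P Kt).d), ∀ z ∈ box (fun κ => (hi κ - lo κ + 1).toNat + 3) (fun κ => lo κ - 2), ∀ b₀ : PBond (F.P Kt) 0,
          (b₀ ∈ feeds (k i) (⟨(castSite z : Site (F.P Kt) (k i)), ⟨0, h0⟩⟩ : PBond (F.P Kt) (k i)) ∨ b₀ ∈ feeds (k i) (⟨((castSite z : Site (F.P Kt) (k i))).shift ⟨0, h0⟩, ν'⟩ : PBond (F.P Kt) (k i))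
          ∨ b₀ ∈ feeds (k i) (⟨((castSite z : Site (F.P Kt) (k i))).shift ν', ⟨0, h0⟩⟩ : PBond (F.P Kt) (k i)) ∨ b₀ ∈ feeds (k i) (⟨(castSite z : Site (F.P Kt) (k i)), ν'⟩ : PBond (F.P Kt) (k i))) →
          ‖((U₀ b₀ : SU2) : Matrix (Fin 2) (Fin 2) ℂ) - 1‖ ≤ δW) →
        ∃ (Ψ₂ : (PBond (F.P Kt) 0 → lieSU (Fin 2)) →L[ℝ] (PBond (F.P Kt) 0 → lieSU (Fin 2)) →L[ℝ] (Fin (constrCard (Bj ν.M₁ Z (k i)) (k i)) → lieSU (Fin 2)))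
          (lam : (Fin (constrCard (Bj ν.M₁ Z (k i)) (k i)) → lieSU (Fin 2)) →L[ℝ] ℝ)
          (p : Seminorm ℝ (PBond (F.P Kt) 0 → lieSU (Fin 2))),
          HasFDerivAt (fun Y => fderiv ℝ (msChart F 2 Kt (k i) (Bj ν.M₁ Z (k i)) (avgFamily (avOfRecord F 2 Kt) (qsstarGIter0 (k i) (ext Vk))) U₀) Y) Ψ₂ 0 ∧
          (∀ᶠ Y in 𝓝 (0 : PBond (F.P Kt) 0 → lieSU (Fin 2)), DifferentiableAt ℝ (msChart F 2 Kt (k i) (Bj ν.M₁ Z (k i)) (avgFamily (avOfRecord F 2 Kt) (qsstarGIter0 (k i) (ext Vk))) U₀) Y) ∧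
          fderiv ℝ (fun Y : PBond (F.P Kt) 0 → lieSU (Fin 2) => wilsonAction4 (expChart U₀ Y)) 0 = lam.comp (fderiv ℝ (msChart F 2 Kt (k i) (Bj ν.M₁ Z (k i)) (avgFamily (avOfRecord F 2 Kt) (qsstarGIter0 (k i) (ext Vk))) U₀) 0) ∧
          (∀ Y : PBond (F.P Kt) 0 → lieSU (Fin 2), ∑ b, ‖(Y b : Matrix (Fin 2) (Fin 2) ℂ)‖ ^ 2 ≤ p Y ^ 2) ∧
          ∀ X : GaugeSlice (pts (k i) Λ) T E3,
            lam (Ψ₂ (fderiv ℝ Xf 0 X) (fderiv ℝ Xf 0 X))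
                ≤ (2 * (((F.P Kt).d : ℝ) - 1) * εP * Real.sqrt (Fintype.card (PBond (F.P Kt) 0)) * B * M₂) * p (fderiv ℝ Xf 0 X) ^ 2 ∧
            p (fderiv ℝ Xf 0 X) ≤ (12 * 𝓐₀ / R * Real.sqrt (Nat.card {b : PBond (F.P Kt) 0 // b.src ∈ maxDomT ν.M₁ Z 1})) * ‖X‖ ∧
            (((F.P Kt).L : ℝ) ^ (F.P Kt).d) ^ (k i) / ((((F.P Kt).L : ℝ)) ^ 2 * ((F.P Kt).L : ℝ) ^ 2) ^ (k i) / 2 * (∑ z ∈ box (fun κ => (hi κ - lo κ + 1).toNat + 3) (fun κ => lo κ - 2), ∑ μ : Fin (F.P Kt).d, ∑ a : Fin 3, curl (fun b => ιA (pts (k i) Λ) T X (⟨castSite b.1, b.2⟩ : PBond (F.P Kt) (k i)) a) z ⟨0, h0⟩ μ ^ 2)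
                - (((F.P Kt).L : ℝ) ^ (F.P Kt).d) ^ (k i) / ((((F.P Kt).L : ℝ)) ^ 2 * ((F.P Kt).L : ℝ) ^ 2) ^ (k i) * (8 * (((F.P Kt).d : ℝ) + 1) * (2 * ((Kτ i) + 1) * δW) + 8 * ((F.P Kt).d : ℝ) * (((box (fun κ => (hi κ - lo κ + 1).toNat + 3) (fun κ => lo κ - 2)).image (fun z => (castSite z : Site (F.P Kt) (k i)))).card : ℝ) * ((C i) * δW * (12 * 𝓐₀ / R * Real.sqrt (Nat.card {b : PBond (F.P Kt) 0 // b.src ∈ maxDomT ν.M₁ Z 1}))) ^ 2) * ‖X‖ ^ 2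
              ≤ ((Fintype.card (Fin 2) : ℝ)⁻¹ • ∑ p ∈ W, (innerSL ℝ (E := lieSU (Fin 2))).bilinearComp
                (ContinuousLinearMap.proj (R := ℝ) (φ := fun _ : PBond (F.P Kt) 0 => lieSU (Fin 2)) (⟨p.src, p.μ⟩ : PBond (F.P Kt) 0) + ContinuousLinearMap.proj (R := ℝ) (φ := fun _ : PBond (F.P Kt) 0 => lieSU (Fin 2)) (⟨p.src.shift p.μ, p.ν⟩ : PBond (F.P Kt) 0)
                  - ContinuousLinearMap.proj (R := ℝ) (φ := fun _ : PBond (F.P Kt) 0 => lieSU (Fin 2)) (⟨p.src.shift p.ν, p.μ⟩ : PBond (F.P Kt) 0) - ContinuousLinearMap.proj (R := ℝ) (φ := fun _ : PBond (F.P Kt) 0 => lieSU (Fin 2)) (⟨p.src, p.ν⟩ : PBond (F.P Kt) 0) : (PBond (F.P Kt) 0 → lieSU (Fin 2)) →L[ℝ] lieSU (Fin 2))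
                (ContinuousLinearMap.proj (R := ℝ) (φ := fun _ : PBond (F.P Kt) 0 => lieSU (Fin 2)) (⟨p.src, p.μ⟩ : PBond (F.P Kt) 0) + ContinuousLinearMap.proj (R := ℝ) (φ := fun _ : PBond (F.P Kt) 0 => lieSU (Fin 2)) (⟨p.src.shift p.μ, p.ν⟩ : PBond (F.P Kt) 0)
                  - ContinuousLinearMap.proj (R := ℝ) (φ := fun _ : PBond (F.P Kt) 0 => lieSU (Fin 2)) (⟨p.src.shift p.ν, p.μ⟩ : PBond (F.P Kt) 0) - ContinuousLinearMap.proj (R := ℝ) (φ := fun _ : PBond (F.P Kt) 0 => lieSU (Fin 2)) (⟨p.src, p.ν⟩ : PBond (F.P Kt) 0) : (PBond (F.P Kt) 0 → lieSU (Fin 2)) →L[ℝ] lieSU (Fin 2))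
                : (PBond (F.P Kt) 0 → lieSU (Fin 2)) →L[ℝ] (PBond (F.P Kt) 0 → lieSU (Fin 2)) →L[ℝ] ℝ) (fderiv ℝ Xf 0 X) (fderiv ℝ Xf 0 X))
    -- the `hsb`-free letter's numeric premises displayed: radius row, the class threshold positive, and its floor against the per-height curvature radius `ρ5`
    (hM4 : 4 * (F.P Kt).L ≤ ν.M₁) (hεreg : 0 < ν.εreg) (hερ : ∀ i, 6 * ((((F.P Kt).d - 1 : ℕ)) : ℝ) * (F.P Kt).L * ν.εreg ≤ ρ5 i)
    -- THE (P4)′ PRODUCER's TWO CONSTANTS, THE (P5) CONSTANT AND THE NEAR-FLAT GUARD RADIUS PER INSTANCE, AS BINDERS (`εH`, `ρ6` per height; `B` per `(M₁, Z)` — never after `εreg`∕`ρn`),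
    -- and THREE LETTERS displayed: `hHB` = the ∀-body of dag-n12-w6 g7's `N12DirectSurjHsurjProxies.exists_rightInverse_letter_of_proxies` (p678596) at `(2, Kt, k i, ν.M₁, Z i; εH i, B i)` —
    -- NO `SmallBelow U₀`: its guarded PROXIES (per constrained bond, per inner site) are produced from the class below; `hsbU` ∕ `hcurv` = the two conjuncts of dag-n12-w4's
    -- `Node00.exists_uniform_chartCurvature_sq_bound (k i)` at `(ρ6 i, M₂ i)` (near-flat fields are guarded; uniform curvature bound at the near-flat core)
    (εH B M₂ ρ6 : ι → ℝ) (hB0 : ∀ i, 0 ≤ B i) (hM₂0 : ∀ i, 0 ≤ M₂ i)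
    (hHB : ∀ i (Wd : MSField (F.P Kt) SU2) (U₀ : GaugeField (F.P Kt) 0 SU2),
      AgreeOn (Bj ν.M₁ (Z i) (k i)) (avgFamily (Node00.avOfRecord F 2 Kt) U₀) Wd →
      (∀ i' : Fin (constrCard (Bj ν.M₁ (Z i) (k i)) (k i)), ∃ U' : GaugeField (F.P Kt) 0 SU2,
        (∀ b ∈ feeds (((constrEnum (Bj ν.M₁ (Z i) (k i)) (k i)).symm i').1 : ℕ) ((constrEnum (Bj ν.M₁ (Z i) (k i)) (k i)).symm i').2.1, U' b = U₀ b) ∧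
          Node00.SmallBelow (Node00.avOfRecord F 2 Kt) (k i) U') →
      (∀ (j : ℕ), 1 ≤ j → j ≤ k i → ∀ y : Site (F.P Kt) j, embIter j y ∈ maxDomT ν.M₁ (Z i) j → ∃ U' : GaugeField (F.P Kt) 0 SU2,
        (∀ c : PBond (F.P Kt) j, (c.src = y ∨ c.tgt = y) → ∀ b₀ : PBond (F.P Kt) 0,
          (iterBlockOf j b₀.src = c.src ∨ iterBlockOf j b₀.src = c.tgt) → (iterBlockOf j b₀.tgt = c.src ∨ iterBlockOf j b₀.tgt = c.tgt) → U' b₀ = U₀ b₀) ∧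
        Node00.SmallBelow (Node00.avOfRecord F 2 Kt) (k i) U') →
      (∀ (j : ℕ), 1 ≤ j → j ≤ k i → ∀ y : Site (F.P Kt) j, embIter j y ∈ maxDomT ν.M₁ (Z i) j →
        PlaqSmallOn (boxPlaqs (fun κ => lift (F.P Kt) (embIter j y) κ - ((((F.P Kt).L ^ j : ℕ) : ℤ) + ((((F.P Kt).L ^ j - 1) / 2 : ℕ) : ℤ)))
          (fun κ => lift (F.P Kt) (embIter j y) κ + ((((F.P Kt).L ^ j : ℕ) : ℤ) + ((((F.P Kt).L ^ j - 1) / 2 : ℕ) : ℤ))) : Set (Plaq (F.P Kt) 0)) (εH i) U₀) →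
      ∃ H : (Fin (constrCard (Bj ν.M₁ (Z i) (k i)) (k i)) → lieSU (Fin 2)) → PBond (F.P Kt) 0 → lieSU (Fin 2),
        (∀ v, fderiv ℝ (msChart F 2 Kt (k i) (Bj ν.M₁ (Z i) (k i)) Wd U₀) 0 (H v) = v) ∧ ∀ v, Real.sqrt (∑ b, ‖H v b‖ ^ 2) ≤ B i * ‖v‖)
    (hsbU : ∀ i (V : GaugeField (F.P Kt) 0 SU2), ‖coeField V - 1‖ ≤ ρ6 i → Node00.SmallBelow (Node00.avOfRecord F 2 Kt) (k i) V)
    (hcurv : ∀ i (𝔹 : DetSet (F.P Kt)) (Wd : MSField (F.P Kt) SU2) (V : GaugeField (F.P Kt) 0 SU2),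
      ‖coeField V - 1‖ ≤ ρ6 i → AgreeOn 𝔹 (avgFamily (Node00.avOfRecord F 2 Kt) V) Wd →
      ∀ w : PBond (F.P Kt) 0 → lieSU (Fin 2), ‖fderiv ℝ (fderiv ℝ (msChart F 2 Kt (k i) 𝔹 Wd V)) 0 w w‖ ≤ M₂ i * ‖w‖ ^ 2)
    -- the near-flat radius's floor on the class threshold (volume-free)
    (hερ6 : ∀ i, 6 * ((((F.P Kt).d - 1 : ℕ)) : ℝ) * (F.P Kt).L * ν.εreg ≤ ρ6 i)
    -- NO letter per guarded base field ∕ minimiser remains here: the (P4)′ socket and the (P5) row are DISCHARGED below from the class through `hHB` ∕ `hsbU` ∕ `hcurv`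
    -- numerics: the positivity constant fits (`γ₀ := 1∕2`: the chart half's level factor `((L^d)^k∕(L²·L²)^k)∕2` at `d = 4`)
    (hγle : ∀ i, γ / (M i) ^ 5 ≤ 1 / 2 / (2 * (3 * (K i : ℝ) ^ 2 + 2 * (K i : ℝ) ^ 4)))
    (hfar : ∀ i (b : PBond (F.P Kt) 0), b.src ∉ maxDomT ν.M₁ (Z i) 1 →
      (⟨blockIter (k i) b.src, b.dir⟩ : PBond (F.P Kt) (k i)) ∉ bondsOf (pts (k i) (Λ i)))
    (hZblk : ∀ i, IsBlockUnion (k i) (Z i))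
    (hM2 : 2 ≤ ν.M₁) (hdiv : ∀ i, side (F.P Kt).L ν.M₁ (k i) ∣ (F.P Kt).sitesPerDir 0)
    {cE B₃ a₀ a₁' cA : ℝ} (hcE0 : 0 ≤ cE) (hcE : ∀ i, 12 * ((F.P Kt).d : ℝ) * ((n i : ℝ) + 2) ^ 2 ≤ cE) (hB₃ : 0 ≤ B₃)
    (heRa : ∀ i, (cE + 1) * eR i ≤ a₁' ∧ B₃ * ((cE + 1) * eR i) ≤ ν.εreg) (ha₀ : ν.εreg ≤ a₀)
    (hcA : 1 / 2 * (B₃ * (cE + 1) * (F.P Kt).eta 1 ^ 2) ^ 2 * (Fintype.card (Plaq (F.P Kt) 0) : ℝ) ≤ cA)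
    (h15T : ∀ (k' : ℕ), k' ≤ (F.P Kt).m + (F.P Kt).K → side (F.P Kt).L ν.M₁ k' ∣ (F.P Kt).sitesPerDir 0 →
      ∀ (s : B14.Eq218Concrete.Seq (fun n : ℕ => Node00.unionsOfCubes (F.P Kt) (side (F.P Kt).L ν.M₁ n)) k'),
      Node00.Sect2.SeqSeparated ν.M₁ s → 0 < ν.M₁ →
      ∀ (ε₀ : ℝ) (δ : ℕ → ℝ), (∀ j, j ≤ k' → 0 < δ j ∧ δ j ≤ a₁' ∧ B₃ * δ j ≤ ε₀) → (∀ j, j < k' → δ j ≤ 2 * δ (j + 1)) →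
      (∀ j, j < k' → δ (j + 1) ≤ 2 * δ j) → ε₀ ≤ a₀ →
      ∀ W : MSField (F.P Kt) SU2,
        Node00.Sect2.DataSmall7PTop (Node00.avOfRecord F 2 Kt) s.Ω (Node00.suppDomOfRecord F ν Kt s.Ω) k' δ W →
        ∀ U₀ : GaugeField (F.P Kt) 0 SU2, IsMinimizer (Node00.avOfRecord F 2 Kt)
            {U | (∀ j, j ≤ k' → PlaqSmallOn (Node00.Sect2.omegaPlaqsTop s.Ω (Node00.suppDomOfRecord F ν Kt s.Ω) j)
                (ε₀ * (F.P Kt).eta j ^ 2) U) ∧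
              Node00.Sect2.CoDivClassOnTop s.Ω (Node00.suppDomOfRecord F ν Kt s.Ω) k' ε₀ U}
            (genSet s.Ω k') W U₀ →
          (∀ j, j ≤ k' → PlaqSmallOn (Node00.Sect2.omegaPlaqsTop s.Ω (Node00.suppDomOfRecord F ν Kt s.Ω) j)
              (B₃ * δ j * (F.P Kt).eta j ^ 2) U₀) ∧
            ∀ j, j ≤ k' → Node00.Sect2.CoDivSmallOn (Node00.Sect2.omegaBondsTop s.Ω (Node00.suppDomOfRecord F ν Kt s.Ω) j)
              (B₃ * δ j * (F.P Kt).eta j ^ 3) U₀)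
    (hcJ' : ∀ i, 2 * cA * eR i / R i + 4 * ((Fintype.card (Plaq (F.P Kt) 0) : ℝ) * (1 + 8 * 𝓐₀ i ^ 4)) / (R i * eR i) ≤ cJ)
    -- THE EXPLICIT-THRESHOLD FRAME (no `∃ δ₀`): tolerances below `Θ i := min (min (ρ i) (ρτ i) ∕ 2) (min 1 (rhs_i ∕ (max S_i 0 + 1)))`, every symbol a binder or a cardinality
    : ∀ δ : ι → ℝ, (∀ i, 0 < δ i) →
      (∀ i, δ i ≤ min (min (min (ρ i) (ρτ i) / 2)
        (min 1 (1 / 2 / (2 * (3 * (K i : ℝ) ^ 2 + 2 * (K i : ℝ) ^ 4)) /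
          (max ((32 * (((F.P Kt).d : ℝ) - 1) + 8 * (((F.P Kt).d : ℝ) - 1) + (2 * (((F.P Kt).d : ℝ) - 1) * Real.sqrt (Fintype.card (PBond (F.P Kt) 0)) * B i * M₂ i)) * (12 * 𝓐₀ i / R i * Real.sqrt (Nat.card {b : PBond (F.P Kt) 0 // b.src ∈ maxDomT ν.M₁ (Z i) 1})) ^ 2
            + (8 * (((F.P Kt).d : ℝ) + 1) * (2 * (Kτ i + 1)) + 8 * ((F.P Kt).d : ℝ) * (((box (fun κ => (hi i κ - lo i κ + 1).toNat + 3) (fun κ => lo i κ - 2)).image (fun z => (castSite z : Site (F.P Kt) (k i)))).card : ℝ) * (C i * (12 * 𝓐₀ i / R i * Real.sqrt (Nat.card {b : PBond (F.P Kt) 0 // b.src ∈ maxDomT ν.M₁ (Z i) 1}))) ^ 2)) 0 + 1)))) (εH i)) →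
      -- (σ)_W THE WINDOW GAUGE LETTER at tolerance `δ i` on the window's plaquette bonds and on the feeds (dag-n12-c's §2 text at `δc = δW := δ i`)
      ∀ (hσW : ∀ i (Vk : GaugeField (F.P Kt) (k i) SU2), PlaqSmallOn (plaqsInside (pts (k i) (Z i ∩ (Λ i)ᶜ))) (eR i) Vk →
      (∀ b ∈ (boxBonds (LO i) (HI i) : Set (PBond (F.P Kt) (k i))), dist1 (ext i Vk b) ≤ ρn i) →
      ∀ U₀ : GaugeField (F.P Kt) 0 SU2,
        IsMinimizer (Node00.avOfRecord F 2 Kt) (Node00.regMSCoPOfRecord F 2 ν Kt (k i) (maxDomT ν.M₁ (Z i))) (Bj ν.M₁ (Z i) (k i))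
          (avgFamily (Node00.avOfRecord F 2 Kt) (qsstarGIter0 (k i) (ext i Vk))) U₀ →
        ∃ σ : GaugeTransf (F.P Kt) 0 SU2,
          (∀ j, j ≤ k i → ∀ b ∈ bondsOf (Bj ν.M₁ (Z i) (k i) j), toMS σ j b.src = 1 ∧ toMS σ j b.tgt = 1) ∧
          (∀ p ∈ W i, ‖((gaugeAct σ U₀ ⟨p.src, p.μ⟩ : SU2) : Matrix (Fin 2) (Fin 2) ℂ) - 1‖ ≤ δ i ∧ ‖((gaugeAct σ U₀ ⟨p.src.shift p.μ, p.ν⟩ : SU2) : Matrix (Fin 2) (Fin 2) ℂ) - 1‖ ≤ δ i ∧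
            ‖((gaugeAct σ U₀ ⟨p.src.shift p.ν, p.μ⟩ : SU2) : Matrix (Fin 2) (Fin 2) ℂ) - 1‖ ≤ δ i ∧ ‖((gaugeAct σ U₀ ⟨p.src, p.ν⟩ : SU2) : Matrix (Fin 2) (Fin 2) ℂ) - 1‖ ≤ δ i) ∧
          (∀ (ν' : Fin (F.P Kt).d), ∀ z ∈ box (fun κ => (hi i κ - lo i κ + 1).toNat + 3) (fun κ => lo i κ - 2), ∀ b₀ : PBond (F.P Kt) 0,
            (b₀ ∈ feeds (k i) (⟨(castSite z : Site (F.P Kt) (k i)), ⟨0, h0⟩⟩ : PBond (F.P Kt) (k i)) ∨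
              b₀ ∈ feeds (k i) (⟨((castSite z : Site (F.P Kt) (k i))).shift ⟨0, h0⟩, ν'⟩ : PBond (F.P Kt) (k i)) ∨
              b₀ ∈ feeds (k i) (⟨((castSite z : Site (F.P Kt) (k i))).shift ν', ⟨0, h0⟩⟩ : PBond (F.P Kt) (k i)) ∨
              b₀ ∈ feeds (k i) (⟨(castSite z : Site (F.P Kt) (k i)), ν'⟩ : PBond (F.P Kt) (k i))) →
            ‖((gaugeAct σ U₀ b₀ : SU2) : Matrix (Fin 2) (Fin 2) ℂ) - 1‖ ≤ δ i))
      -- THE PLAQUETTE LETTER at tolerance `δ i`: every (2.12) minimiser of the guarded datum is `δ i`-plaquette-small on the plaquettes with a bond starting in `Ω₁(Z_i)` (P1 and the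
      -- chart half's (μ)-row input; the class ∕ [15] Thm 1 (8) reading)
      (hPχ : ∀ i (Vk : GaugeField (F.P Kt) (k i) SU2), PlaqSmallOn (plaqsInside (pts (k i) (Z i ∩ (Λ i)ᶜ))) (eR i) Vk →
      (∀ b ∈ (boxBonds (LO i) (HI i) : Set (PBond (F.P Kt) (k i))), dist1 (ext i Vk b) ≤ ρn i) →
      ∀ U₀ : GaugeField (F.P Kt) 0 SU2,
        IsMinimizer (Node00.avOfRecord F 2 Kt) (Node00.regMSCoPOfRecord F 2 ν Kt (k i) (maxDomT ν.M₁ (Z i))) (Bj ν.M₁ (Z i) (k i))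
          (avgFamily (Node00.avOfRecord F 2 Kt) (qsstarGIter0 (k i) (ext i Vk))) U₀ →
        ∀ p : Plaq (F.P Kt) 0, ((⟨p.src, p.μ⟩ : PBond (F.P Kt) 0) ∈ {b : PBond (F.P Kt) 0 | b.src ∈ maxDomT ν.M₁ (Z i) 1} ∨
            (⟨p.src.shift p.μ, p.ν⟩ : PBond (F.P Kt) 0) ∈ {b : PBond (F.P Kt) 0 | b.src ∈ maxDomT ν.M₁ (Z i) 1} ∨
            (⟨p.src.shift p.ν, p.μ⟩ : PBond (F.P Kt) 0) ∈ {b : PBond (F.P Kt) 0 | b.src ∈ maxDomT ν.M₁ (Z i) 1} ∨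
            (⟨p.src, p.ν⟩ : PBond (F.P Kt) 0) ∈ {b : PBond (F.P Kt) 0 | b.src ∈ maxDomT ν.M₁ (Z i) 1}) →
          ‖((GaugeField.plaqHol U₀ p : SU2) : Matrix (Fin 2) (Fin 2) ℂ) - 1‖ ≤ δ i)
      -- THE TOWER-BOX PLAQUETTE LETTER at tolerance `δ i` (the plaquette premise of dag-n12-w6's (P4)′ producer `exists_rightInverse_letter`, verbatim at `(2, Kt, k i, ν.M₁, Z i)`):
      -- every (2.12) minimiser of the guarded datum is `δ i`-plaquette-small on the fine box of half-width `L^j + (L^j − 1)∕2` around `ι_j y` for every inner `j`-site `y` (`1 ≤ j ≤ k i`)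
      (hPbox : ∀ i (Vk : GaugeField (F.P Kt) (k i) SU2), PlaqSmallOn (plaqsInside (pts (k i) (Z i ∩ (Λ i)ᶜ))) (eR i) Vk →
      (∀ b ∈ (boxBonds (LO i) (HI i) : Set (PBond (F.P Kt) (k i))), dist1 (ext i Vk b) ≤ ρn i) →
      ∀ U₀ : GaugeField (F.P Kt) 0 SU2,
        IsMinimizer (Node00.avOfRecord F 2 Kt) (Node00.regMSCoPOfRecord F 2 ν Kt (k i) (maxDomT ν.M₁ (Z i))) (Bj ν.M₁ (Z i) (k i))
          (avgFamily (Node00.avOfRecord F 2 Kt) (qsstarGIter0 (k i) (ext i Vk))) U₀ →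
        ∀ (j : ℕ), 1 ≤ j → j ≤ k i → ∀ y : Site (F.P Kt) j, embIter j y ∈ maxDomT ν.M₁ (Z i) j →
          PlaqSmallOn (boxPlaqs (fun κ => lift (F.P Kt) (embIter j y) κ - ((((F.P Kt).L ^ j : ℕ) : ℤ) + ((((F.P Kt).L ^ j - 1) / 2 : ℕ) : ℤ)))
            (fun κ => lift (F.P Kt) (embIter j y) κ + ((((F.P Kt).L ^ j : ℕ) : ℤ) + ((((F.P Kt).L ^ j - 1) / 2 : ℕ) : ℤ))) : Set (Plaq (F.P Kt) 0)) (δ i) U₀),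
      ∃ a₁ : ι → ℝ, (∀ i, 0 < a₁ i) ∧
      B15.Prop1Printed (lfVarOn su2Chart fun i =>
        InstOn.std (Node00.bgMSCoPOfRecord F 2 ν Kt (k i) (maxDomT ν.M₁ (Z i))) ν.M₁ (Z i) (Λ i) (k i) (M i) (a₁ i)
          (anExt (pts (k i) (Λ i)) (T i)
            (fun177std (Node00.bgMSCoPOfRecord F 2 ν Kt (k i) (maxDomT ν.M₁ (Z i))) ν.M₁ (Z i) (k i)) (ext i)
            (min (1 / 2) (min (R i / 8) (γ / (M i) ^ 5 * (R i / 2) ^ 2 /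
              (48 * (4 * ((Fintype.card (Plaq (F.P Kt) 0) : ℝ) * (1 + 8 * 𝓐₀ i ^ 4)) / R i + 1))))))) := by
  intro δ hδpos hδle hσW hPχ hPbox
  -- (P2c)″ with (P4)′ fed by the proxies edition at `δ i ≤ εH i` (proxies from the class) and (P5) by the class curvature bound
  exact exists_domain_prop1Printed_lfVarOn_std_su2_box_intrinsic_analytic_atZSeqCoPRecord_ofThm1TorusClass_ofMinimiserFamily_ofWindowGaugeLetter_ofChartHalfOfClass_explicit
    ν Kt hd3 h0 Z Λ k M hk0 hk1 eR heR T lo hi n hn hN hbox hZ hTG0 hN5 K hK1 hKn ext hext hlohi LO HI hLO hHI n' hn' hn'N hR' ρn hρn hγ hcJ hbx hbxM hM hR h𝓐₀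
    hMin hΩw W hWbox C ρ Kτ ρτ ρ5 hρ hKτ hρτ hhalf hM4 hεreg hερ B M₂ hB0 hM₂0
    (fun i Vk hg hdat U₀ hmin => hHB i _ U₀ hmin.2.1
      (towerProxies_Bj_of_mem_class ν Kt (Z i) (hk1 i) hM4 (hdiv i) hεreg.le (hsbU i) (hερ6 i) hmin.1)
      (siteProxies_Bj_of_mem_class ν Kt (Z i) (hk1 i) hM4 (hdiv i) hεreg.le (hsbU i) (hερ6 i) hmin.1)
      fun j hj1 hjk y hy => plaqSmallOn_of_le ((hδle i).trans (min_le_right _ _)) (hPbox i Vk hg hdat U₀ hmin j hj1 hjk y hy))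
    (fun i Vk _ _ U₀ hmin w => norm_fderiv_fderiv_msChart_le_of_class ν Kt (Z i) (hk1 i) hM4 (hdiv i) hεreg.le (hM₂0 i) (hsbU i) (hcurv i) (hερ6 i) hmin w)
    hγle hfar hZblk hM2 hdiv hcE0 hcE hB₃ heRa ha₀ hcA h15T hcJ'
    δ hδpos (fun i => (hδle i).trans (min_le_left _ _)) hσW hPχ

/-! ## §2  The displayed letter families are INHABITED by their producers (per height ∕ per `(M₁, Z)`) — junctions by `choose` -/

/-- **JUNCTION (count-neutral)**: dag-n12-w6 g7's PROXIES edition `N12DirectSurjHsurjProxies.exists_rightInverse_letter_of_proxies` (p678596) inhabits §1's letter family `hHB` with its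
constants — `εH i > 0` per height `k i` (BEFORE `ν`), `B i ≥ 0` per `(ν.M₁, Z i)` (never after `εreg` or the datum tolerances).  Needs `k i + 1 ≤ m + K`, `1 ≤ M₁`, (2.13)'s divisibility.
[cite: Balaban1985Variational, (83) p.290, (44)–(47) p.285; Balaban1988Convergent, (2.2) p.255, (2.11)–(2.13) pp.256–257] -/
theorem exists_rightInverseProxiesLetter_family (ν : Node00.Stage7Numerics) (Kt : ℕ) {ι : Type} (Z : ι → Set (Site (F.P Kt) 0)) (k : ι → ℕ)
    (hk1 : ∀ i, k i + 1 ≤ (F.P Kt).m + (F.P Kt).K) (hM2 : 2 ≤ ν.M₁) (hdiv : ∀ i, side (F.P Kt).L ν.M₁ (k i) ∣ (F.P Kt).sitesPerDir 0) :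
    ∃ εH : ι → ℝ, (∀ i, 0 < εH i) ∧ ∃ B : ι → ℝ, (∀ i, 0 ≤ B i) ∧
      ∀ i (Wd : MSField (F.P Kt) SU2) (U₀ : GaugeField (F.P Kt) 0 SU2),
      AgreeOn (Bj ν.M₁ (Z i) (k i)) (avgFamily (Node00.avOfRecord F 2 Kt) U₀) Wd →
      (∀ i' : Fin (constrCard (Bj ν.M₁ (Z i) (k i)) (k i)), ∃ U' : GaugeField (F.P Kt) 0 SU2,
        (∀ b ∈ feeds (((constrEnum (Bj ν.M₁ (Z i) (k i)) (k i)).symm i').1 : ℕ) ((constrEnum (Bj ν.M₁ (Z i) (k i)) (k i)).symm i').2.1, U' b = U₀ b) ∧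
          Node00.SmallBelow (Node00.avOfRecord F 2 Kt) (k i) U') →
      (∀ (j : ℕ), 1 ≤ j → j ≤ k i → ∀ y : Site (F.P Kt) j, embIter j y ∈ maxDomT ν.M₁ (Z i) j → ∃ U' : GaugeField (F.P Kt) 0 SU2,
        (∀ c : PBond (F.P Kt) j, (c.src = y ∨ c.tgt = y) → ∀ b₀ : PBond (F.P Kt) 0,
          (iterBlockOf j b₀.src = c.src ∨ iterBlockOf j b₀.src = c.tgt) → (iterBlockOf j b₀.tgt = c.src ∨ iterBlockOf j b₀.tgt = c.tgt) → U' b₀ = U₀ b₀) ∧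
        Node00.SmallBelow (Node00.avOfRecord F 2 Kt) (k i) U') →
      (∀ (j : ℕ), 1 ≤ j → j ≤ k i → ∀ y : Site (F.P Kt) j, embIter j y ∈ maxDomT ν.M₁ (Z i) j →
        PlaqSmallOn (boxPlaqs (fun κ => lift (F.P Kt) (embIter j y) κ - ((((F.P Kt).L ^ j : ℕ) : ℤ) + ((((F.P Kt).L ^ j - 1) / 2 : ℕ) : ℤ)))
          (fun κ => lift (F.P Kt) (embIter j y) κ + ((((F.P Kt).L ^ j : ℕ) : ℤ) + ((((F.P Kt).L ^ j - 1) / 2 : ℕ) : ℤ))) : Set (Plaq (F.P Kt) 0)) (εH i) U₀) →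
      ∃ H : (Fin (constrCard (Bj ν.M₁ (Z i) (k i)) (k i)) → lieSU (Fin 2)) → PBond (F.P Kt) 0 → lieSU (Fin 2),
        (∀ v, fderiv ℝ (msChart F 2 Kt (k i) (Bj ν.M₁ (Z i) (k i)) Wd U₀) 0 (H v) = v) ∧ ∀ v, Real.sqrt (∑ b, ‖H v b‖ ^ 2) ≤ B i * ‖v‖ := by
  choose εH hεH hBex using fun i => exists_rightInverse_letter_of_proxies (F := F) (N := 2) (K := Kt) (k := k i) (hk1 i)
  choose B hB0 hHB using fun i => hBex i ν.M₁ (le_trans one_le_two hM2) (Z i) (hdiv i)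
  exact ⟨εH, hεH, B, hB0, hHB⟩

/-- **JUNCTION (count-neutral)**: dag-n12-w4's `Node00.exists_uniform_chartCurvature_sq_bound (k i)` inhabits §1's letters `hsbU` ∕ `hcurv` with `ρ6 i > 0`, `M₂ i ≥ 0` per HEIGHT
(before `ν`). [cite: Balaban1985Variational, Sect. C (44)–(48) p.285, (81)–(83) p.290; Balaban1988Convergent, (2.10)–(2.12) p.256] -/
theorem exists_curvatureLetters_family (Kt : ℕ) {ι : Type} (k : ι → ℕ) :
    ∃ ρ6 M₂ : ι → ℝ, (∀ i, 0 < ρ6 i) ∧ (∀ i, 0 ≤ M₂ i) ∧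
      (∀ i (V : GaugeField (F.P Kt) 0 SU2), ‖coeField V - 1‖ ≤ ρ6 i → Node00.SmallBelow (Node00.avOfRecord F 2 Kt) (k i) V) ∧
      ∀ i (𝔹 : DetSet (F.P Kt)) (Wd : MSField (F.P Kt) SU2) (V : GaugeField (F.P Kt) 0 SU2),
        ‖coeField V - 1‖ ≤ ρ6 i → AgreeOn 𝔹 (avgFamily (Node00.avOfRecord F 2 Kt) V) Wd →
        ∀ w : PBond (F.P Kt) 0 → lieSU (Fin 2), ‖fderiv ℝ (fderiv ℝ (msChart F 2 Kt (k i) 𝔹 Wd V)) 0 w w‖ ≤ M₂ i * ‖w‖ ^ 2 := by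
  choose M₂ ρ6 hM₂ hρ6 hsbU hcurv using fun i => Node00.exists_uniform_chartCurvature_sq_bound (F := F) (N := 2) (K := Kt) (k i)
  exact ⟨ρ6, M₂, hρ6, hM₂, hsbU, hcurv⟩

end Summit.QuantumFields.YangMills.BalabanUVNodes.N12Prop1DirectOfClassOnly

end
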